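import Literature.Geometry.Manifold.SubmersionLift
import Literature.Geometry.Manifold.InjOnLocalDiffeomorphInverse
import Mathlib.Analysis.InnerProductSpace.Calculus
import Mathlib.Analysis.SpecialFunctions.Trigonometric.Deriv
import Mathlib.Geometry.Manifold.VectorBundle.ContMDiffSection
import Mathlib.Geometry.Manifold.Instances.Real
import HarnessLib

/-!
# Local lifts for the field `W` with `W(F) = 2 (F - b)`, `W(β) = 0` (field layer, part 1)

Auxiliary file (part 1 of 2) of helper `helper_bott_field` of stub
`helper_sliceGluing_bottRecognition` (fibred Morse–Bott recognition of the polar tube), line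
`Sketch`, crux `SblfDescent.RungOne`.

(Crux item stmt-SmoothPoincare4-18531; skeleton `Cruxes/RungOne/Lines/Sketch.lean`.)

On a smooth `4`-manifold `X` with smooth `F : X → ℝ`, `β : X → ℝ²`, we want a smooth vector
field `W` with `dF(W) = 2 (F - b)` and `dβ(W) = 0` (a lift of a prescribed pair through the map
`(F, β)`, in the manner of the lifts of coordinate fields in the proof of Ehresmann's theorem,
Bröcker–Jänich (1982), (8.12): local lifts glued by a partition of unity, the conditions being
affine).  This file provides the two kinds of LOCAL lifts:

* `BottField.exists_local_lift_euler` — **near the critical circle**, where `(F, β)` has a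
  Morse–Bott chart `τ = (s, y) : X ⊇ O → ℝ × ℝ³` (`F = b - ‖y‖²`, `β = (cos 2πs, sin 2πs)`, `dτ`
  bijective), the pull-back of the Euler field `y ∂_y` (Mathlib's `VectorField.mpullback`,
  smooth by `ContMDiffAt.mpullback_vectorField_preimage`) satisfies both conditions and
  vanishes where `F = b`;
* `BottField.exists_local_lift_regular` — **at a regular point** `x₀` (where `(dF, dβ)` maps
  onto `ℝ × (β x₀)ᗮ` and `‖β‖ = 1` nearby), a local lift of `(1, 0)` through
  `g = F e₀ + ⟪β, Jβ(x₀)⟫ e₁ : X → ℝ²` (`Literature.Geometry.Manifold.exists_local_lift_of_surjective_mfderiv`)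
  rescaled by `2 (F - b)` satisfies both conditions near `x₀` (`dβ(W) ⊥ β` because `‖β‖ = 1`,
  and `⊥ Jβ(x₀)`, hence `dβ(W) = 0` while `⟪β, β x₀⟫ > 0`: `BottField.eq_zero_of_inner`).

## References

* Th. Bröcker, K. Jänich, *Introduction to Differential Topology*, CUP 1982, (8.12) (proof).
  [BrockerJanichIDT1982]
-/

set_option linter.dupNamespace false

noncomputable section

open scoped Manifold ContDiff Topology RealInnerProductSpace
open Set Function Filter Metric VectorField

namespace Summit.SmoothPoincare4.SmoothPoincare4.Cruxes.RungOne.Sketch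

namespace BottField

/-! ### Plane geometry: `ℝ²` -/

/-- The basis vector `e₀ = (1, 0)`. [folklore] -/
abbrev e₀ : EuclideanSpace ℝ (Fin 2) := EuclideanSpace.single 0 1
/-- The basis vector `e₁ = (0, 1)`. [folklore] -/
abbrev e₁ : EuclideanSpace ℝ (Fin 2) := EuclideanSpace.single 1 1

/-- `(r e₀ + s e₁)₀ = r`. [folklore] -/
@[simp] theorem comb_apply_zero (r s : ℝ) : (r • e₀ + s • e₁) 0 = r := by simp
/-- `(r e₀ + s e₁)₁ = s`. [folklore] -/
@[simp] theorem comb_apply_one (r s : ℝ) : (r • e₀ + s • e₁) 1 = s := by simp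

/-- Every `z ∈ ℝ²` is `z₀ e₀ + z₁ e₁`. [folklore] -/
theorem eq_comb (z : EuclideanSpace ℝ (Fin 2)) : z = z 0 • e₀ + z 1 • e₁ := by
  ext i; fin_cases i <;> simp

/-- **The rotation by a right angle** `J (p₀, p₁) = (-p₁, p₀)`. [folklore] -/
def rot (p : EuclideanSpace ℝ (Fin 2)) : EuclideanSpace ℝ (Fin 2) := (-p 1) • e₀ + p 0 • e₁

/-- `J p ⊥ p`. [folklore] -/
theorem inner_rot_self (p : EuclideanSpace ℝ (Fin 2)) : ⟪rot p, p⟫ = 0 := by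
  rw [PiLp.inner_apply, Fin.sum_univ_two, rot]
  simp only [comb_apply_zero, comb_apply_one, RCLike.inner_apply, conj_trivial]
  ring

/-- `‖J p‖ = ‖p‖` (as `⟪J p, J p⟫ = ‖p‖²`). [folklore] -/
theorem inner_rot_rot (p : EuclideanSpace ℝ (Fin 2)) : ⟪rot p, rot p⟫ = ‖p‖ ^ 2 := by
  rw [← real_inner_self_eq_norm_sq p, PiLp.inner_apply, PiLp.inner_apply, Fin.sum_univ_two,
    Fin.sum_univ_two, rot]
  simp only [comb_apply_zero, comb_apply_one, RCLike.inner_apply, conj_trivial]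
  ring

/-- **A vector of `ℝ²` orthogonal to `J p` (`‖p‖ = 1`) and to some `q` with `⟪q, p⟫ > 0`
vanishes.** [folklore] -/
theorem eq_zero_of_inner {p q w : EuclideanSpace ℝ (Fin 2)} (hp : ‖p‖ = 1) (h1 : ⟪w, rot p⟫ = 0)
    (h2 : ⟪w, q⟫ = 0) (h3 : 0 < ⟪q, p⟫) : w = 0 := by
  have hin : ∀ x y : EuclideanSpace ℝ (Fin 2), ⟪x, y⟫ = x 0 * y 0 + x 1 * y 1 := fun x y => by
    rw [PiLp.inner_apply, Fin.sum_univ_two]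
    simp only [RCLike.inner_apply, conj_trivial]
    ring
  have hp' : p 0 ^ 2 + p 1 ^ 2 = 1 := by
    have h := real_inner_self_eq_norm_sq p
    rw [hin, hp] at h
    nlinarith [h]
  rw [hin, rot, comb_apply_zero, comb_apply_one] at h1
  rw [hin] at h2 h3
  set μ := w 0 * p 0 + w 1 * p 1 with hμ
  have hw0 : w 0 = μ * p 0 := by linear_combination (-(w 0)) * hp' + (-(p 1)) * h1
  have hw1 : w 1 = μ * p 1 := by linear_combination (-(w 1)) * hp' + (p 0) * h1
  have hμ0 : μ * (q 0 * p 0 + q 1 * p 1) = 0 := by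
    rw [hw0, hw1] at h2; linear_combination h2
  have hμz : μ = 0 := (mul_eq_zero.1 hμ0).resolve_right h3.ne'
  rw [eq_comb w, hw0, hw1, hμz]; simp

/-- **The circle vector** `(cos 2πs, sin 2πs)`. [folklore] -/
def circ (s : ℝ) : EuclideanSpace ℝ (Fin 2) := Real.cos (2 * Real.pi * s) • e₀ + Real.sin (2 * Real.pi * s) • e₁

/-- `circ` is smooth. [folklore] -/
theorem contDiff_circ : ContDiff ℝ ∞ circ := by
  unfold circ
  exact ((Real.contDiff_cos.comp (contDiff_const.mul contDiff_id)).smul contDiff_const).add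
    ((Real.contDiff_sin.comp (contDiff_const.mul contDiff_id)).smul contDiff_const)

/-! ### Differentials of maps into vector spaces -/

section MFDeriv

variable {E H : Type*} [NormedAddCommGroup E] [NormedSpace ℝ E] [TopologicalSpace H]
  {I : ModelWithCorners ℝ E H} {M : Type*} [TopologicalSpace M] [ChartedSpace H M]
  {V V' : Type*} [NormedAddCommGroup V] [NormedSpace ℝ V] [NormedAddCommGroup V'] [NormedSpace ℝ V']

/-- `d(L ∘ φ) = L ∘ dφ` for a continuous linear `L`. [folklore] -/
theorem hasMFDerivAt_clm_apply (L : V →L[ℝ] V') {φ : M → V} {x : M}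
    {φ' : TangentSpace I x →L[ℝ] TangentSpace 𝓘(ℝ, V) (φ x)} (hφ : HasMFDerivAt I 𝓘(ℝ, V) φ x φ') :
    HasMFDerivAt I 𝓘(ℝ, V') (fun y => L (φ y)) x (L.comp φ') :=
  (L.hasMFDerivAt (x := φ x)).comp x hφ

/-- `d(G ∘ φ) = DG ∘ dφ` for a differentiable map `G` between vector spaces. [folklore] -/
theorem hasMFDerivAt_comp_of_hasFDerivAt {G : V → V'} {φ : M → V} {x : M} {G' : V →L[ℝ] V'}
    (hG : HasFDerivAt G G' (φ x))
    {φ' : TangentSpace I x →L[ℝ] TangentSpace 𝓘(ℝ, V) (φ x)} (hφ : HasMFDerivAt I 𝓘(ℝ, V) φ x φ') :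
    HasMFDerivAt I 𝓘(ℝ, V') (G ∘ φ) x (G'.comp φ') :=
  hG.hasMFDerivAt.comp x hφ

/-- **`dβ ⊥ β` where `‖β‖ = 1`**: if `‖β‖ = 1` near `x` then `⟪β x, dβ(v)⟫ = 0`. [folklore] -/
theorem inner_mfderiv_eq_zero_of_norm_eq_one {W : Type*} [NormedAddCommGroup W] [InnerProductSpace ℝ W]
    {β : M → W} {x : M} (hβ : MDifferentiableAt I 𝓘(ℝ, W) β x)
    (h1 : ∀ᶠ y in 𝓝 x, ‖β y‖ = 1) (v : TangentSpace I x) : ⟪β x, mfderiv I 𝓘(ℝ, W) β x v⟫ = 0 := by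
  have hd : HasMFDerivAt I 𝓘(ℝ, ℝ) (fun y => ‖β y‖ ^ 2) x
      ((2 • (innerSL ℝ (β x))).comp (mfderiv I 𝓘(ℝ, W) β x)) := by
    have h := (hasStrictFDerivAt_norm_sq (β x)).hasFDerivAt
    exact hasMFDerivAt_comp_of_hasFDerivAt (G := fun w : W => ‖w‖ ^ 2) h hβ.hasMFDerivAt
  have hc : HasMFDerivAt I 𝓘(ℝ, ℝ) (fun y => ‖β y‖ ^ 2) x (0 : TangentSpace I x →L[ℝ] ℝ) := by
    have h0 : HasMFDerivAt I 𝓘(ℝ, ℝ) (fun _ : M => (1 : ℝ)) x (0 : TangentSpace I x →L[ℝ] ℝ) :=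
      hasMFDerivAt_const (1 : ℝ) x
    refine h0.congr_of_eventuallyEq ?_
    filter_upwards [h1] with y hy
    simp [hy]
  have huniq := hd.mfderiv.symm.trans hc.mfderiv
  have h := congrArg (fun L : TangentSpace I x →L[ℝ] ℝ => L v) huniq
  have h' : (2 • innerSL ℝ (β x)) (mfderiv I 𝓘(ℝ, W) β x v) = (0 : ℝ) := h
  rw [two_nsmul, FunLike.coe_add, Pi.add_apply, innerSL_apply_apply] at h'
  change ⟪β x, mfderiv I 𝓘(ℝ, W) β x v⟫ + ⟪β x, mfderiv I 𝓘(ℝ, W) β x v⟫ = 0 at h'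
  linarith

end MFDeriv

/-! ### The Euler field near the critical circle -/

section Euler

variable {X : Type} [TopologicalSpace X] [ChartedSpace (EuclideanSpace ℝ (Fin 4)) X]
  [IsManifold (𝓡 4) ∞ X]

/-- `dF(v) ∈ ℝ` for a real function (the value of `mfderiv`, typed in `ℝ`). [folklore] -/
abbrev dF (F : X → ℝ) (x : X) (v : TangentSpace (𝓡 4) x) : ℝ := mfderiv (𝓡 4) 𝓘(ℝ, ℝ) F x v

/-- `dβ(v) ∈ ℝ²` for a plane-valued map (the value of `mfderiv`, typed in `ℝ²`). [folklore] -/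
abbrev dV (β : X → EuclideanSpace ℝ (Fin 2)) (x : X) (v : TangentSpace (𝓡 4) x) : EuclideanSpace ℝ (Fin 2) :=
  mfderiv (𝓡 4) 𝓘(ℝ, EuclideanSpace ℝ (Fin 2)) β x v

/-- The model function `b - ‖y‖²` on `ℝ × ℝ³`. [folklore] -/
def modelF (b : ℝ) (q : ℝ × EuclideanSpace ℝ (Fin 3)) : ℝ := b - ‖q.2‖ ^ 2

/-- Its differential: `d(b - ‖y‖²)(q) = -2 ⟪y, ·⟫ ∘ pr₂`. [folklore] -/
theorem hasFDerivAt_modelF (b : ℝ) (q : ℝ × EuclideanSpace ℝ (Fin 3)) :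
    HasFDerivAt (modelF b) (-(2 • (innerSL ℝ q.2).comp
      (ContinuousLinearMap.snd ℝ ℝ (EuclideanSpace ℝ (Fin 3))))) q := by
  have h := ((hasFDerivAt_snd (𝕜 := ℝ) (E := ℝ) (F := EuclideanSpace ℝ (Fin 3)) (p := q)).norm_sq)
  have h2 := (hasFDerivAt_const b q).sub h
  rw [zero_sub] at h2
  exact h2

/-- The model angle `circ ∘ pr₁` on `ℝ × ℝ³` has differential killing `(0, w)`. [folklore] -/
theorem hasFDerivAt_circ_fst (q : ℝ × EuclideanSpace ℝ (Fin 3)) :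
    HasFDerivAt (fun q : ℝ × EuclideanSpace ℝ (Fin 3) => circ q.1)
      ((fderiv ℝ circ q.1).comp (ContinuousLinearMap.fst ℝ ℝ (EuclideanSpace ℝ (Fin 3)))) q :=
  ((contDiff_circ.differentiable (by simp)) q.1).hasFDerivAt.comp q hasFDerivAt_fst

/-- The Euler field `(0, y)` on `ℝ × ℝ³`. [folklore] -/
def eulerModel (q : ℝ × EuclideanSpace ℝ (Fin 3)) : TangentSpace 𝓘(ℝ, ℝ × EuclideanSpace ℝ (Fin 3)) q :=
  ((0 : ℝ), q.2)

/-- The Euler field is a smooth vector field on `ℝ × ℝ³`. [folklore] -/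
theorem contMDiffAt_eulerModel (q : ℝ × EuclideanSpace ℝ (Fin 3)) :
    ContMDiffAt 𝓘(ℝ, ℝ × EuclideanSpace ℝ (Fin 3)) 𝓘(ℝ, ℝ × EuclideanSpace ℝ (Fin 3)).tangent ∞
      (fun q => (⟨q, eulerModel q⟩ : TangentBundle 𝓘(ℝ, ℝ × EuclideanSpace ℝ (Fin 3))
        (ℝ × EuclideanSpace ℝ (Fin 3)))) q :=
  contMDiffAt_vectorSpace_iff_contDiffAt.2 ((contDiff_const.prodMk contDiff_snd).contDiffAt)

omit [IsManifold (𝓡 4) ∞ X] in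
/-- A bijective differential is invertible. [folklore] -/
theorem isInvertible_of_bijective {τ : X → ℝ × EuclideanSpace ℝ (Fin 3)} {x : X}
    (h : Bijective (mfderiv (𝓡 4) 𝓘(ℝ, ℝ × EuclideanSpace ℝ (Fin 3)) τ x)) :
    (mfderiv (𝓡 4) 𝓘(ℝ, ℝ × EuclideanSpace ℝ (Fin 3)) τ x).IsInvertible := by
  exact ⟨Literature.Geometry.Manifold.continuousLinearEquivOfBijective (E := EuclideanSpace ℝ (Fin 4))
      (E' := ℝ × EuclideanSpace ℝ (Fin 3)) (mfderiv (𝓡 4) 𝓘(ℝ, ℝ × EuclideanSpace ℝ (Fin 3)) τ x) h,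
    Literature.Geometry.Manifold.coe_continuousLinearEquivOfBijective (E := EuclideanSpace ℝ (Fin 4))
      (E' := ℝ × EuclideanSpace ℝ (Fin 3)) _ h⟩

/-- **The Euler lift near the critical circle.**  Let `τ : X ⊇ O → ℝ × ℝ³` (`O` open) be smooth
with bijective differentials, `F = b - ‖pr₂ τ‖²` and `β = circ (pr₁ τ)` on `O`.  Then the
pull-back `E` of the Euler field `(0, y)` by `τ` is a smooth vector field on `O` with
`dF(E) = 2 (F - b)`, `dβ(E) = 0`, and `E = 0` where `F = b`.
[cite: BrockerJanichIDT1982, (8.12) (proof, local lifts)] -/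
theorem exists_local_lift_euler {F : X → ℝ} {β : X → EuclideanSpace ℝ (Fin 2)} {b : ℝ}
    {O : Set X} {τ : X → ℝ × EuclideanSpace ℝ (Fin 3)} (hO : IsOpen O)
    (hτ : ContMDiffOn (𝓡 4) 𝓘(ℝ, ℝ × EuclideanSpace ℝ (Fin 3)) ∞ τ O)
    (hbij : ∀ x ∈ O, Bijective (mfderiv (𝓡 4) 𝓘(ℝ, ℝ × EuclideanSpace ℝ (Fin 3)) τ x))
    (hF : ∀ x ∈ O, F x = b - ‖(τ x).2‖ ^ 2) (hβ : ∀ x ∈ O, β x = circ (τ x).1) :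
    ∃ E : Π x : X, TangentSpace (𝓡 4) x,
      ContMDiffOn (𝓡 4) (𝓡 4).tangent ∞ (fun x => (⟨x, E x⟩ : TangentBundle (𝓡 4) X)) O ∧
      ∀ x ∈ O, mfderiv (𝓡 4) 𝓘(ℝ, ℝ) F x (E x) = 2 * (F x - b) ∧
        mfderiv (𝓡 4) 𝓘(ℝ, EuclideanSpace ℝ (Fin 2)) β x (E x) = 0 ∧ (F x = b → E x = 0) := by
  set E : Π x : X, TangentSpace (𝓡 4) x :=
    mpullback (𝓡 4) 𝓘(ℝ, ℝ × EuclideanSpace ℝ (Fin 3)) τ eulerModel with hE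
  have hEx : ∀ x, E x = (mfderiv (𝓡 4) 𝓘(ℝ, ℝ × EuclideanSpace ℝ (Fin 3)) τ x).inverse ((0 : ℝ), (τ x).2) :=
    fun x => rfl
  refine ⟨E, fun x hx => ?_, fun x hx => ?_⟩
  · exact (ContMDiffAt.mpullback_vectorField_preimage (n := ∞) (contMDiffAt_eulerModel (τ x))
      (hτ.contMDiffAt (hO.mem_nhds hx)) (isInvertible_of_bijective (hbij x hx)) (by simp)).contMDiffWithinAt
  · have hinv := isInvertible_of_bijective (hbij x hx)
    have hτd : HasMFDerivAt (𝓡 4) 𝓘(ℝ, ℝ × EuclideanSpace ℝ (Fin 3)) τ x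
        (mfderiv (𝓡 4) 𝓘(ℝ, ℝ × EuclideanSpace ℝ (Fin 3)) τ x) :=
      ((hτ.contMDiffAt (hO.mem_nhds hx)).mdifferentiableAt (by simp)).hasMFDerivAt
    have happly : mfderiv (𝓡 4) 𝓘(ℝ, ℝ × EuclideanSpace ℝ (Fin 3)) τ x (E x) = ((0 : ℝ), (τ x).2) := by
      rw [hEx]; exact Literature.Geometry.Manifold.apply_inverse_of_isInvertible hinv _
    refine ⟨?_, ?_, fun hxb => ?_⟩
    · -- `F = modelF ∘ τ` near `x`
      have hd : HasMFDerivAt (𝓡 4) 𝓘(ℝ, ℝ) (modelF b ∘ τ) x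
          ((-(2 • (innerSL ℝ (τ x).2).comp
            (ContinuousLinearMap.snd ℝ ℝ (EuclideanSpace ℝ (Fin 3))))).comp
            (mfderiv (𝓡 4) 𝓘(ℝ, ℝ × EuclideanSpace ℝ (Fin 3)) τ x)) :=
        hasMFDerivAt_comp_of_hasFDerivAt (hasFDerivAt_modelF b (τ x)) hτd
      have heq : modelF b ∘ τ =ᶠ[𝓝 x] F := by
        filter_upwards [hO.mem_nhds hx] with y hy
        exact (hF y hy).symm
      have key : dF F x (E x) = -(‖(τ x).2‖ ^ 2 + ‖(τ x).2‖ ^ 2) := by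
        unfold dF
        rw [(hd.congr_of_eventuallyEq heq.symm).mfderiv]
        change -((2 • (innerSL ℝ (τ x).2).comp (ContinuousLinearMap.snd ℝ ℝ (EuclideanSpace ℝ (Fin 3))))
          (mfderiv (𝓡 4) 𝓘(ℝ, ℝ × EuclideanSpace ℝ (Fin 3)) τ x (E x))) = _
        rw [happly, two_nsmul]
        change -(⟪(τ x).2, (τ x).2⟫ + ⟪(τ x).2, (τ x).2⟫) = _
        rw [real_inner_self_eq_norm_sq]
      have key' : dF F x (E x) = 2 * (F x - b) := by
        rw [key, hF x hx]; ring
      exact key'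
    · -- `β = circ ∘ pr₁ ∘ τ` near `x`
      have hd : HasMFDerivAt (𝓡 4) 𝓘(ℝ, EuclideanSpace ℝ (Fin 2))
          ((fun q : ℝ × EuclideanSpace ℝ (Fin 3) => circ q.1) ∘ τ) x
          (((fderiv ℝ circ (τ x).1).comp (ContinuousLinearMap.fst ℝ ℝ (EuclideanSpace ℝ (Fin 3)))).comp
            (mfderiv (𝓡 4) 𝓘(ℝ, ℝ × EuclideanSpace ℝ (Fin 3)) τ x)) :=
        hasMFDerivAt_comp_of_hasFDerivAt (hasFDerivAt_circ_fst (τ x)) hτd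
      have heq : ((fun q : ℝ × EuclideanSpace ℝ (Fin 3) => circ q.1) ∘ τ) =ᶠ[𝓝 x] β := by
        filter_upwards [hO.mem_nhds hx] with y hy
        exact (hβ y hy).symm
      have key : dV β x (E x) = 0 := by
        unfold dV
        rw [(hd.congr_of_eventuallyEq heq.symm).mfderiv]
        change (fderiv ℝ circ (τ x).1) (ContinuousLinearMap.fst ℝ ℝ (EuclideanSpace ℝ (Fin 3))
          (mfderiv (𝓡 4) 𝓘(ℝ, ℝ × EuclideanSpace ℝ (Fin 3)) τ x (E x))) = 0
        rw [happly]
        exact map_zero _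
      exact key
    · have h0 : (τ x).2 = 0 := by
        have h := hF x hx
        rw [hxb] at h
        have : ‖(τ x).2‖ ^ 2 = 0 := by linarith
        exact norm_eq_zero.1 (by simpa using this)
      rw [hEx, h0]
      exact map_zero _

end Euler

/-! ### The lift at a regular point -/

section Regular

variable {X : Type} [TopologicalSpace X] [ChartedSpace (EuclideanSpace ℝ (Fin 4)) X]
  [IsManifold (𝓡 4) ∞ X]

/-- **The lift at a regular point.**  Let `F : X → ℝ`, `β : X → ℝ²` be smooth, `x₀` a point with
`‖β‖ = 1` near `x₀` (on the open set `{a₁ < F} ∋ x₀`) at which `(dF, dβ)` maps onto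
`ℝ × (β x₀)ᗮ`.  Then near `x₀` there is a smooth vector field `W` with `dF(W) = 2 (F - b)` and
`dβ(W) = 0`. [cite: BrockerJanichIDT1982, (8.12) (proof, local lifts)] -/
theorem exists_local_lift_regular {F : X → ℝ} {β : X → EuclideanSpace ℝ (Fin 2)} {a₁ b : ℝ}
    (hF : ContMDiff (𝓡 4) 𝓘(ℝ, ℝ) ∞ F) (hβ : ContMDiff (𝓡 4) 𝓘(ℝ, EuclideanSpace ℝ (Fin 2)) ∞ β)
    (hnorm : ∀ x, a₁ < F x → ‖β x‖ = 1) {x₀ : X} (hx₀ : a₁ < F x₀)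
    (hsurj : ∀ (r : ℝ) (w : EuclideanSpace ℝ (Fin 2)), ⟪w, β x₀⟫ = 0 →
      ∃ y : EuclideanSpace ℝ (Fin 4), mfderiv (𝓡 4) 𝓘(ℝ, ℝ) F x₀ y = r ∧
        mfderiv (𝓡 4) 𝓘(ℝ, EuclideanSpace ℝ (Fin 2)) β x₀ y = w) :
    ∃ U ∈ 𝓝 x₀, ∃ W : Π x : X, TangentSpace (𝓡 4) x,
      ContMDiffOn (𝓡 4) (𝓡 4).tangent ∞ (fun x => (⟨x, W x⟩ : TangentBundle (𝓡 4) X)) U ∧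
      ∀ x ∈ U, mfderiv (𝓡 4) 𝓘(ℝ, ℝ) F x (W x) = 2 * (F x - b) ∧
        mfderiv (𝓡 4) 𝓘(ℝ, EuclideanSpace ℝ (Fin 2)) β x (W x) = 0 := by
  set c : EuclideanSpace ℝ (Fin 2) := rot (β x₀) with hc
  -- the auxiliary map `g = F e₀ + ⟪c, β⟫ e₁ : X → ℝ²`
  set L₀ : ℝ →L[ℝ] EuclideanSpace ℝ (Fin 2) := (ContinuousLinearMap.id ℝ ℝ).smulRight e₀ with hL₀
  set L₁ : EuclideanSpace ℝ (Fin 2) →L[ℝ] EuclideanSpace ℝ (Fin 2) :=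
    (innerSL ℝ c).smulRight e₁ with hL₁
  have hL₀a : ∀ r : ℝ, L₀ r = r • e₀ := fun r => by simp [hL₀]
  have hL₁a : ∀ w : EuclideanSpace ℝ (Fin 2), L₁ w = ⟪c, w⟫ • e₁ := fun w => by
    simp [hL₁, innerSL_apply_apply]
  set g : X → EuclideanSpace ℝ (Fin 2) := fun y => L₀ (F y) + L₁ (β y) with hg
  have hgs : ContMDiff (𝓡 4) 𝓘(ℝ, EuclideanSpace ℝ (Fin 2)) ∞ g :=
    (L₀.contDiff.comp_contMDiff hF).add (L₁.contDiff.comp_contMDiff hβ)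
  -- its differential
  have hdg : ∀ (y : X) (v : EuclideanSpace ℝ (Fin 4)),
      dV g y v = dF F y v • e₀ + ⟪c, dV β y v⟫ • e₁ := by
    intro y v
    have h1 := hasMFDerivAt_clm_apply L₀ ((hF.mdifferentiableAt (by simp) (x := y)).hasMFDerivAt)
    have h2 := hasMFDerivAt_clm_apply L₁ ((hβ.mdifferentiableAt (by simp) (x := y)).hasMFDerivAt)
    have h3 : HasMFDerivAt (𝓡 4) 𝓘(ℝ, EuclideanSpace ℝ (Fin 2)) g y
        (L₀.comp (mfderiv (𝓡 4) 𝓘(ℝ, ℝ) F y) +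
          L₁.comp (mfderiv (𝓡 4) 𝓘(ℝ, EuclideanSpace ℝ (Fin 2)) β y)) := h1.add h2
    unfold dV
    rw [h3.mfderiv]
    exact congrArg₂ (· + ·) (hL₀a _) (hL₁a _)
  -- surjective at `x₀`
  have hn₀ : ‖β x₀‖ = 1 := hnorm x₀ hx₀
  have hsurj' : Surjective (mfderiv (𝓡 4) 𝓘(ℝ, EuclideanSpace ℝ (Fin 2)) g x₀) := by
    intro z'
    set z : EuclideanSpace ℝ (Fin 2) := z' with hz
    obtain ⟨y, hy1, hy2⟩ := hsurj (z 0) (z 1 • c) (by rw [real_inner_smul_left, hc, inner_rot_self, mul_zero])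
    refine ⟨y, ?_⟩
    show dV g x₀ y = z
    rw [hdg]
    have e1 : dF F x₀ y = z 0 := hy1
    have e2 : dV β x₀ y = z 1 • c := hy2
    rw [e1, e2, real_inner_smul_right, hc, inner_rot_rot, hn₀, one_pow, mul_one]
    exact (eq_comb z).symm
  obtain ⟨U₁, hU₁, W₁, hW₁s, hW₁⟩ :=
    Literature.Geometry.Manifold.exists_local_lift_of_surjective_mfderiv hgs hsurj' e₀
  -- consequences of `dg(W₁) = e₀`
  have hW₁F : ∀ y ∈ U₁, dF F y (W₁ y) = 1 := fun y hy => by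
    have h : dV g y (W₁ y) = e₀ := hW₁ y hy
    rw [hdg] at h
    have h0 := congrArg (fun z : EuclideanSpace ℝ (Fin 2) => z 0) h
    simpa using h0
  have hW₁β : ∀ y ∈ U₁, ⟪c, dV β y (W₁ y)⟫ = 0 := fun y hy => by
    have h : dV g y (W₁ y) = e₀ := hW₁ y hy
    rw [hdg] at h
    have h1 := congrArg (fun z : EuclideanSpace ℝ (Fin 2) => z 1) h
    simpa using h1
  -- the neighbourhood
  set U : Set X := U₁ ∩ {y | a₁ < F y} ∩ {y | 0 < ⟪β y, β x₀⟫} with hU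
  have hU₁o : {y | a₁ < F y} ∈ 𝓝 x₀ := (isOpen_lt continuous_const hF.continuous).mem_nhds hx₀
  have hU₂o : {y : X | 0 < ⟪β y, β x₀⟫} ∈ 𝓝 x₀ := by
    refine (isOpen_lt continuous_const (hβ.continuous.inner continuous_const)).mem_nhds ?_
    show 0 < ⟪β x₀, β x₀⟫
    rw [real_inner_self_eq_norm_sq, hn₀]; norm_num
  have hUn : U ∈ 𝓝 x₀ := inter_mem (inter_mem hU₁ hU₁o) hU₂o
  set W : Π x : X, TangentSpace (𝓡 4) x := fun y => (2 * (F y - b)) • W₁ y with hW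
  refine ⟨U, hUn, W, ?_, fun y hy => ?_⟩
  · have hf : ContMDiffOn (𝓡 4) 𝓘(ℝ, ℝ) ∞ (fun y => 2 * (F y - b)) U :=
      (contMDiff_const.mul (hF.sub contMDiff_const)).contMDiffOn
    exact hf.smul_section (hW₁s.mono fun y hy => hy.1.1)
  · obtain ⟨⟨hy₁, hy₂⟩, hy₃⟩ := hy
    have hβy : ∀ᶠ z in 𝓝 y, ‖β z‖ = 1 := by
      filter_upwards [(isOpen_lt continuous_const hF.continuous).mem_nhds hy₂] with z hz
      exact hnorm z hz
    have hw : dV β y (W₁ y) = 0 := by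
      refine eq_zero_of_inner hn₀ ?_ ?_ hy₃
      · rw [real_inner_comm]; exact hW₁β y hy₁
      · rw [real_inner_comm]
        exact inner_mfderiv_eq_zero_of_norm_eq_one (hβ.mdifferentiableAt (by simp)) hβy _
    refine ⟨?_, ?_⟩
    · have h1 : dF F y (W y) = (2 * (F y - b)) * dF F y (W₁ y) := by
        unfold dF
        rw [show W y = (2 * (F y - b)) • W₁ y from rfl, map_smul]
        rfl
      rw [hW₁F y hy₁, mul_one] at h1
      exact h1
    · have h1 : dV β y (W y) = (2 * (F y - b)) • dV β y (W₁ y) := by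
        unfold dV
        rw [show W y = (2 * (F y - b)) • W₁ y from rfl, map_smul]
        rfl
      rw [hw, smul_zero] at h1
      exact h1

end Regular

end BottField

end Summit.SmoothPoincare4.SmoothPoincare4.Cruxes.RungOne.Sketch

end
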